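import Literature.Computability.AlgebraicComplexity.HI16BinaryDC
import Literature.Computability.AlgebraicComplexity.SymmetricDetRepresentationProofs
import Literature.Computability.AlgebraicComplexity.CircuitGateSemantics
import Literature.Computability.AlgebraicComplexity.ConstantFreeCircuits
import HarnessLib

/-!
# `VP_s^0 = DET^0` — discharge of `huttenhainIkenmeyer2016_prop12` (Hüttenhain–Ikenmeyer 2016, Prop. 5.2)

Discharge (D-0014) of the named fact
`Literature.Computability.AlgebraicComplexity.huttenhainIkenmeyer2016_prop12` (`HI16BinaryDC.lean`,
§5): J. Hüttenhain, C. Ikenmeyer, *Binary determinantal complexity*, Linear Algebra Appl. 504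
(2016) = arXiv:1410.8202 [HuttenhainIkenmeyer2016], **Proposition 5.2** (PDF p. 8, l. 40; held text
`paper:arxiv-1410.8202` p0009:L32): "`VP_s^0 = DET^0`" — the sequences of integer polynomials with
polynomially bounded constant-free skew complexity (`IsVPsZeroFamily`: fan-in-two circuits with
constants and sum coefficients in `{0, 1, −1}`, every product gate having an input among its two
operands, size = number of gates) are exactly the sequences with polynomially bounded binary
determinantal complexity (`IsDETZeroFamily`, Def. 5.1).

## The printed proof (p0009:L33–L36) and what is formalised

* `DET^0 ⊆ VP_s^0`: "The proof of [Tod92, Lemma 3.4] immediately shows that `DET^0 ⊆ VP_s^0`" —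
  Toda's Lemma 3.4 is the polynomial-size skew circuit for the determinant from the
  Samuelson–Berkowitz algorithm (= Malod–Portier 2008, Prop. 5: "We recall here Berkowitz's
  algorithm … this computation can be done by a weakly skew circuit of polynomial size").
  FORMALISED as `isVPsZeroFamily_of_isDETZeroFamily`: the tree already holds a layered algebraic
  branching program for `det_n` over every commutative ring — the Mahajan–Vinay/Berkowitz program
  `GKKP2011.bigN`, `GKKP2011.srcVec`, `GKKP2011.snkVec` of `SymmetricDetRepresentationProofs.lean`
  with `GKKP2011.abpValue_eq_detPoly : a · (∑_{j ≤ n} (−N)^j) · b = det_n`, all of whose weights are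
  variables, `0` or `±1`. The generic engine `HI16Skew.exists_skewCircuit_dotProduct` turns ANY such
  program (square weight matrix `N`, border vectors `a`, `b`, entries in `{X_i, 0, 1, −1}`) into a
  constant-free SKEW circuit computing `a · (∑_{j<m} (−N)^j) · b`: it evaluates the recursion
  `y^{(r+1)} = b − N y^{(r)}`, `y^{(0)} = 0`, coordinate by coordinate, every product being
  "weight (an input) × previously computed coordinate", of size `≤ (m+1)(2|V|+3)²`. Substituting
  the entries `0, 1, X_v` of a binary variable matrix for the inputs `X_{ij}` of this circuit
  (`ArithCircuit.substCircuit`, which keeps fan-in, sign constants and skewness) gives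
  `bdc(f) ≤ s ⇒` a constant-free skew circuit for `f` of size `≤ (s+2)(4s³+7)²`.
* `VP_s^0 ⊆ DET^0`: "adapt the proof of [Tod92, Lemma 3.5 or Theorem 4.3] … from a skew circuit
  `C` we can construct a matrix `A′` of size polynomially bounded in the number of vertices in
  `C` such that `det(A′)` is the polynomial computed by `C` … `A′` has as entries variables and
  constants `0, 1, −1`. Fortunately Proposition 2.3 establishes `DET^0 = VP_s^0`." FORMALISED as
  `hasBinaryDetRepr_of_isSkew` / `isDETZeroFamily_of_isVPsZeroFamily`: the universal digraph of a
  skew circuit (Malod–Portier 2008, Lemma 5; Toda 1992) in the rendering of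
  `HI16BinaryDC.lean` (digraph = adjacency matrix, Hüttenhain–Ikenmeyer's signed `pathValue`,
  Lemma 6.2's `mergeMatrix` with `HuttenhainIkenmeyer.det_mergeMatrix_eq_pathValue`): vertices
  `s`, `t`, one vertex per gate and TWO private "middle" vertices per gate (one per operand), every
  operand contributing the 2-arc path `source(operand) → middle → gate` (labels: the operand's
  input label resp. `1` for a gate reference, then the sum coefficient resp. the input factor of a
  skew product), so that all `s`–gate paths have even length and the alternating sign of
  `pathValue` is the same global sign for every gate (`HI16Skew.sval_vG`, by strong induction
  on the gate number with the per-gate semantics `ArithCircuit.gateVal_of_sum/_of_prod` of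
  `CircuitGateSemantics.lean`); one final arc into `t` fixes the sign. The merged matrix has size
  `3s + 1` (`s` = number of gates) and entries variables, `0`, `±1`; Prop. 2.3 in its discharged
  explicit form (`HuttenhainIkenmeyer.prop6Matrix`, `det_prop6Matrix`, `card_prop6Index_le`,
  constant `4`) makes it binary of size `≤ (3s+1) + 4(3s+1)²`, uniformly in the variable type —
  which is what a FAMILY indexed by `n` with varying variable types `ς n` needs.
* `huttenhainIkenmeyer2016_prop12_holds` assembles the two inclusions; p-boundedness by the
  tree's `IsPBounded.add/mul/pow/comp_holds`.

Deviations, disclosed: (i) the source proves `DET^0 ⊆ VP_s^0` by citing Toda's skew circuit for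
the determinant; we use the tree's PROVED branching program for `det_n` (Mahajan–Vinay 1997 in
Berkowitz orientation, `GKKP2011.abpValue_eq_detPoly`), unrolled as the recursion
`y ↦ b − N y` — the same algorithmic content (an iterated product of matrices with input entries),
a different but equally polynomial size bound (`O(s⁷)` gates; the source claims only
"polynomially bounded"). (ii) The weakly-skew class `VP_ws^0` of the printed chain
`DET^0 = VP_s^0 = VP_ws^0` is not part of the typed statement and is not treated here.
No new definitions of record, no named facts: net debt `−1`.

## References

* [HuttenhainIkenmeyer2016] J. Hüttenhain, C. Ikenmeyer, *Binary determinantal complexity*,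
  Linear Algebra Appl. 504 (2016) 559–573; arXiv:1410.8202, §5, Prop. 5.2 and its proof.
* [Toda1992] S. Toda, *Classes of arithmetic circuits capturing the complexity of computing the
  determinant*, IEICE Trans. Inf. Syst. E75-D (1992) 116–124, Lemmas 3.4, 3.5, Thm. 4.3.
* [MalodPortier2008] G. Malod, N. Portier, *Characterizing Valiant's algebraic complexity
  classes*, J. Complexity 24 (2008) 16–38, Lemma 5 (circuit → graph) and Prop. 5 (Berkowitz's
  algorithm by weakly skew circuits) (held: `paper:doi-10-1016-j-jco-2006-09-006`, p0012, p0016).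
* [MahajanVinay1997] M. Mahajan, V. Vinay, *Determinant: combinatorics, algorithms, and
  complexity*, Chicago J. Theoret. Comput. Sci. 1997, §3.
-/

noncomputable section

open MvPolynomial Finset

namespace Literature.Computability.AlgebraicComplexity

universe u v w

namespace HI16Skew

open ArithCircuit

/-! ## Part A. A builder for constant-free skew straight-line programs

Gates are appended one at a time at the END of the gate list, with absolute references to earlier
gates, so that no index shifting is ever needed; a *handle* is an operand (an input, or a reference
to an already emitted gate) whose value is read off the value list `gateValues`. -/

section Builder

variable {k : Type u} [CommRing k] {σ : Type v}

/-- The value of a handle `h` against the gate list `gs`. [folklore] -/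
def hval (gs : List (Gate k σ)) (h : Operand k σ) : MvPolynomial σ k := h.eval (gateValues gs)

/-- A handle is usable after `gs`: it refers below `|gs|` and carries sign constants (bookkeeping of the
straight-line programs in Malod–Portier's proof of Prop. 5). [cite: MalodPortier2008, Prop. 5 (proof)] -/
def HOk (gs : List (Gate k σ)) (h : Operand k σ) : Prop := h.RefsBelow gs.length ∧ h.HasSignConstants

/-- An input operand: a variable or a constant in `{0, 1, −1}` (never a gate reference).
[cite: HuttenhainIkenmeyer2016, §5] -/
def IsInput (a : Operand k σ) : Prop := a.isGateRef = false ∧ a.HasSignConstants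

/-- A gate of a fan-in-two constant-free skew circuit. [cite: HuttenhainIkenmeyer2016, §5] -/
def GoodGate (g : Gate k σ) : Prop := g.fanIn ≤ 2 ∧ g.HasSignConstants ∧ g.IsSkew

/-- All gates are good. [cite: HuttenhainIkenmeyer2016, §5] -/
def Good (gs : List (Gate k σ)) : Prop := ∀ g ∈ gs, GoodGate g

/-- Appending a good gate. [folklore] -/
private theorem Good.snoc {gs : List (Gate k σ)} {g : Gate k σ} (hgs : Good gs)
    (hg : GoodGate g) : Good (gs ++ [g]) := by
  intro x hx
  rw [List.mem_append, List.mem_singleton] at hx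
  rcases hx with hx | rfl
  · exact hgs x hx
  · exact hg

/-- The empty program is good. [folklore] -/
private theorem good_nil : Good ([] : List (Gate k σ)) := fun g hg => by simp at hg

/-- Usability is monotone along extensions. [folklore] -/
private theorem HOk.mono {gs gs' : List (Gate k σ)} {h : Operand k σ}
    (hh : HOk gs h) (hle : gs.length ≤ gs'.length) : HOk gs' h := by
  refine ⟨?_, hh.2⟩
  cases h with
  | var i => trivial
  | const c => trivial
  | gate j => exact lt_of_lt_of_le (show j < gs.length from hh.1) hle

/-- An input is usable everywhere. [folklore] -/
private theorem IsInput.hOk {a : Operand k σ} (ha : IsInput a)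
    (gs : List (Gate k σ)) : HOk gs a := by
  cases a with
  | var i => exact ⟨trivial, ha.2⟩
  | const c => exact ⟨trivial, ha.2⟩
  | gate j => exact absurd ha.1 (by simp [Operand.isGateRef])

/-- A reference to the last emitted gate is usable. [folklore] -/
private theorem hOk_last (gs : List (Gate k σ)) (g : Gate k σ) :
    HOk (gs ++ [g]) (Operand.gate gs.length : Operand k σ) :=
  ⟨by simp [Operand.RefsBelow], Operand.hasSignConstants_gate _⟩

/-- The value of a usable handle does not change when gates are appended. [folklore] -/
private theorem hval_append {gs more : List (Gate k σ)} {h : Operand k σ} (hh : h.RefsBelow gs.length) :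
    hval (gs ++ more) h = hval gs h := by
  cases h with
  | var i => rfl
  | const c => rfl
  | gate j =>
    have hj : j < gs.length := hh
    have h1 : (gateValues (gs ++ more)).take gs.length = gateValues gs := by
      rw [← gateValues_take_eq_take, List.take_left]
    simp only [hval, Operand.eval_gate, List.getD_eq_getElem?_getD]
    rw [← h1, List.getElem?_take, if_pos hj]

/-- The value of a usable handle along a prefix extension. [folklore] -/
private theorem hval_of_prefix {gs gs' : List (Gate k σ)} (hp : gs <+: gs') {h : Operand k σ}
    (hh : h.RefsBelow gs.length) : hval gs' h = hval gs h := by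
  obtain ⟨more, rfl⟩ := hp
  exact hval_append hh

/-- The value of the last emitted gate. [folklore] -/
private theorem hval_last (gs : List (Gate k σ)) (g : Gate k σ) :
    hval (gs ++ [g]) (Operand.gate gs.length) = g.eval (gateValues gs) := by
  simp only [hval, Operand.eval_gate, gateValues_append_singleton, List.getD_eq_getElem?_getD]
  rw [List.getElem?_append_right (by simp), gateValues_length, Nat.sub_self,
    List.getElem?_cons_zero, Option.getD_some]

/-- The value of an input does not depend on the gate list. [folklore] -/
private theorem hval_input {a : Operand k σ} (ha : a.isGateRef = false) (gs gs' : List (Gate k σ)) :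
    hval gs a = hval gs' a := by
  cases a with
  | var i => rfl
  | const c => rfl
  | gate j => simp [Operand.isGateRef] at ha

/-- A skew product gate `h * a` with an input `a`. [folklore] -/
private theorem eval_prod_pair (vals : List (MvPolynomial σ k)) (h a : Operand k σ) :
    (Gate.prod [h, a]).eval vals = h.eval vals * a.eval vals := by
  simp [Gate.eval]

/-- The empty sum gate computes `0`. [folklore] -/
private theorem eval_sum_nil (vals : List (MvPolynomial σ k)) :
    (Gate.sum ([] : List (k × Operand k σ))).eval vals = 0 := by
  simp [Gate.eval]

/-- A binary weighted sum gate. [folklore] -/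
private theorem eval_sum_pair (vals : List (MvPolynomial σ k)) (c₁ c₂ : k) (h₁ h₂ : Operand k σ) :
    (Gate.sum [(c₁, h₁), (c₂, h₂)]).eval vals = c₁ • h₁.eval vals + c₂ • h₂.eval vals := by
  simp [Gate.eval]

/-- A product `h * a` with an input `a` is a good (skew) gate. [cite: HuttenhainIkenmeyer2016, §5] -/
theorem goodGate_prod_pair {h a : Operand k σ} (hh : h.HasSignConstants)
    (ha : IsInput a) : GoodGate (Gate.prod [h, a]) := by
  refine ⟨by simp [Gate.fanIn, Gate.args], ?_, ?_⟩
  · intro u hu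
    simp only [List.mem_cons, List.not_mem_nil, or_false] at hu
    rcases hu with rfl | rfl
    · exact hh
    · exact ha.2
  · show [h, a].countP Operand.isGateRef ≤ 1
    rw [List.countP_cons, List.countP_cons, List.countP_nil, ha.1]
    cases h <;> simp [Operand.isGateRef]

/-- The empty sum gate is good. [folklore] -/
private theorem goodGate_sum_nil :
    GoodGate (Gate.sum ([] : List (k × Operand k σ))) :=
  ⟨by simp [Gate.fanIn, Gate.args], fun a ha => by simp at ha, trivial⟩

/-- A binary weighted sum gate with sign coefficients is good. [folklore] -/
private theorem goodGate_sum_pair {c₁ c₂ : k} {h₁ h₂ : Operand k σ}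
    (hc₁ : IsSignConstant c₁) (hc₂ : IsSignConstant c₂) (hh₁ : h₁.HasSignConstants)
    (hh₂ : h₂.HasSignConstants) : GoodGate (Gate.sum [(c₁, h₁), (c₂, h₂)]) := by
  refine ⟨by simp [Gate.fanIn, Gate.args], ?_, trivial⟩
  intro a ha
  simp only [List.mem_cons, List.not_mem_nil, or_false] at ha
  rcases ha with rfl | rfl
  · exact ⟨hc₁, hh₁⟩
  · exact ⟨hc₂, hh₂⟩

/-- The negative of a sign constant is a sign constant. [folklore] -/
private theorem isSignConstant_neg {c : k} (hc : IsSignConstant c) : IsSignConstant (-c) := by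
  rcases hc with rfl | rfl | h
  · exact Or.inl neg_zero
  · exact Or.inr (Or.inr (by simp))
  · have : c = -1 := by
      have := eq_neg_of_add_eq_zero_left h
      simpa using this
    subst this
    exact Or.inr (Or.inl (by simp))

/-! ### Signed linear combinations `∑ c • (h * a)` -/

/-- **Signed linear combination.** For a list of terms `(c, h, a)` (sign coefficient `c`, handle
`h`, input `a`) append gates computing `∑ c • (h * a)`: one skew product and one binary sum per
term, after an initial empty sum; returns the extended gate list and the handle of the result.
[cite: MalodPortier2008, Prop. 5 (proof)] -/
def slc : List (Gate k σ) → List (k × Operand k σ × Operand k σ) → List (Gate k σ) × Operand k σ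
  | gs, [] => (gs ++ [Gate.sum []], .gate gs.length)
  | gs, (c, h, a) :: rest =>
    ((slc gs rest).1 ++ [Gate.prod [h, a]] ++
        [Gate.sum [(1, (slc gs rest).2), (c, .gate (slc gs rest).1.length)]],
      .gate ((slc gs rest).1.length + 1))

/-- Unfolding `slc` on the empty term list. [folklore] -/
private theorem slc_nil (gs : List (Gate k σ)) :
    slc gs ([] : List (k × Operand k σ × Operand k σ)) = (gs ++ [Gate.sum []], .gate gs.length) := rfl

/-- Unfolding `slc` on a nonempty term list. [folklore] -/
private theorem slc_cons (gs : List (Gate k σ)) (c : k) (h a : Operand k σ)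
    (rest : List (k × Operand k σ × Operand k σ)) :
    slc gs ((c, h, a) :: rest) =
      ((slc gs rest).1 ++ [Gate.prod [h, a]] ++
          [Gate.sum [(1, (slc gs rest).2), (c, .gate (slc gs rest).1.length)]],
        .gate ((slc gs rest).1.length + 1)) := rfl

/-- The value of a term `(c, h, a)` against `gs`. [folklore] -/
def termVal (gs : List (Gate k σ)) (t : k × Operand k σ × Operand k σ) : MvPolynomial σ k :=
  t.1 • (hval gs t.2.1 * hval gs t.2.2)

/-- A well-formed term list: sign coefficients, usable handles, input factors.
[cite: MalodPortier2008, Prop. 5 (proof)] -/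
def TermsOk (gs : List (Gate k σ)) (ts : List (k × Operand k σ × Operand k σ)) : Prop :=
  ∀ t ∈ ts, IsSignConstant t.1 ∧ HOk gs t.2.1 ∧ IsInput t.2.2

/-- **Specification of `slc`**: it extends the program by exactly `2|terms| + 1` good gates and
the returned handle is usable and reads `∑ c • (h * a)`. [cite: MalodPortier2008, Prop. 5 (proof)] -/
theorem slc_spec {gs : List (Gate k σ)} (hgs : Good gs) :
    ∀ ts : List (k × Operand k σ × Operand k σ), TermsOk gs ts →
      gs <+: (slc gs ts).1 ∧ Good (slc gs ts).1 ∧ HOk (slc gs ts).1 (slc gs ts).2 ∧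
        hval (slc gs ts).1 (slc gs ts).2 = (ts.map (termVal gs)).sum ∧
        (slc gs ts).1.length = gs.length + 2 * ts.length + 1
  | [], _ => by
    rw [slc_nil]
    refine ⟨List.prefix_append _ _, hgs.snoc goodGate_sum_nil, hOk_last _ _, ?_, by simp⟩
    show hval (gs ++ [Gate.sum []]) (Operand.gate gs.length) = _
    rw [hval_last, eval_sum_nil, List.map_nil, List.sum_nil]
  | (c, h, a) :: rest, hts => by
    have hrest : TermsOk gs rest := fun t ht => hts t (List.mem_cons_of_mem _ ht)
    obtain ⟨hc, hh, ha⟩ := hts (c, h, a) (List.mem_cons_self ..)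
    obtain ⟨hpre, hgood, hok, hv, hlen⟩ := slc_spec hgs rest hrest
    rw [slc_cons]
    have hv1 : hval ((slc gs rest).1 ++ [Gate.prod [h, a]]) (.gate (slc gs rest).1.length) =
        hval gs h * hval gs a := by
      rw [hval_last, eval_prod_pair]
      change hval (slc gs rest).1 h * hval (slc gs rest).1 a = _
      rw [hval_of_prefix hpre hh.1, hval_input ha.1 (slc gs rest).1 gs]
    have hgood1 : Good ((slc gs rest).1 ++ [Gate.prod [h, a]]) :=
      hgood.snoc (goodGate_prod_pair hh.2 ha)
    have hlen1 : ((slc gs rest).1 ++ [Gate.prod [h, a]]).length = (slc gs rest).1.length + 1 := by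
      simp
    refine ⟨?_, ?_, ?_, ?_, ?_⟩
    · exact hpre.trans ((List.prefix_append _ _).trans (List.prefix_append _ _))
    · exact hgood1.snoc (goodGate_sum_pair isSignConstant_one hc hok.2
        (Operand.hasSignConstants_gate _))
    · have := hOk_last ((slc gs rest).1 ++ [Gate.prod [h, a]])
        (Gate.sum [(1, (slc gs rest).2), (c, .gate (slc gs rest).1.length)] : Gate k σ)
      rwa [hlen1] at this
    · have hval2 := hval_last ((slc gs rest).1 ++ [Gate.prod [h, a]])
        (Gate.sum [(1, (slc gs rest).2), (c, .gate (slc gs rest).1.length)] : Gate k σ)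
      rw [hlen1] at hval2
      rw [hval2, eval_sum_pair, one_smul]
      change hval ((slc gs rest).1 ++ [Gate.prod [h, a]]) (slc gs rest).2 +
        c • hval ((slc gs rest).1 ++ [Gate.prod [h, a]]) (.gate (slc gs rest).1.length) = _
      rw [hval_append hok.1, hv, hv1, List.map_cons, List.sum_cons]
      exact add_comm _ _
    · simp only [List.length_append, List.length_cons, List.length_nil, hlen]
      omega

/-- Negating every summand negates a list sum. [folklore] -/
private theorem list_sum_map_neg {α : Type*} (l : List α) (f : α → MvPolynomial σ k) :
    (l.map fun a => -f a).sum = -(l.map f).sum := by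
  induction l with
  | nil => simp
  | cons a l ih => rw [List.map_cons, List.sum_cons, List.map_cons, List.sum_cons, ih, neg_add]

end Builder

/-! ## Part B. From a branching program with input weights to a skew circuit

For a square matrix `N` and vectors `a`, `b` with entries in `{X_i, 0, 1, −1}` and a number `m`
of rounds, a constant-free skew circuit computing `a · (∑_{j<m} (−N)^j) · b` by the recursion
`y^{(0)} = 0`, `y^{(r+1)} = b − N y^{(r)}` (so `y^{(m)} = (∑_{j<m} (−N)^j) b`). -/

section Program

variable {k : Type u} [CommRing k] {σ : Type v}

/-- The admissible weights: a variable, `0`, `1` or `−1`. [cite: MalodPortier2008, Prop. 5 (proof)] -/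
def IsSInput (e : MvPolynomial σ k) : Prop := e = 0 ∨ e = 1 ∨ e = -1 ∨ ∃ x, e = X x

/-- The value of an input operand (independent of any gate list). [folklore] -/
def ival (a : Operand k σ) : MvPolynomial σ k := a.eval []

omit [CommRing k] in
/-- `hval` of an input is `ival`. [folklore] -/
private theorem hval_eq_ival [CommRing k] {a : Operand k σ} (ha : a.isGateRef = false)
    (gs : List (Gate k σ)) : hval gs a = ival a :=
  hval_input ha gs []

/-- An admissible weight is `c • ival a` for a sign constant `c` and an input `a ∈ {1, X_i}`.
[folklore] -/
private theorem IsSInput.exists_repr {e : MvPolynomial σ k} (he : IsSInput e) :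
    ∃ p : k × Operand k σ, IsSignConstant p.1 ∧ IsInput p.2 ∧ e = p.1 • ival p.2 := by
  rcases he with rfl | rfl | rfl | ⟨x, rfl⟩
  · exact ⟨(0, .const 1), isSignConstant_zero, ⟨rfl, isSignConstant_one⟩, by simp⟩
  · refine ⟨(1, .const 1), isSignConstant_one, ⟨rfl, isSignConstant_one⟩, ?_⟩
    simp [ival, Operand.eval]
  · refine ⟨(-1, .const 1), isSignConstant_neg_one, ⟨rfl, isSignConstant_one⟩, ?_⟩
    simp [ival, Operand.eval]
  · refine ⟨(1, .var x), isSignConstant_one, ⟨rfl, trivial⟩, ?_⟩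
    simp [ival, Operand.eval]

variable {V : Type w} [DecidableEq V]

/-- One coordinate of a round: gates for `b_v − ∑_{w ∈ L} N_{vw} y_w` from the handles `hy` of
the previous round (`Nc`, `bc` are the chosen representations `(c, a)` of the weights).
[cite: MalodPortier2008, Prop. 5 (proof)] -/
def vstep (Nc : V → V → k × Operand k σ) (bc : V → k × Operand k σ) (L : List V)
    (hy : V → Operand k σ) (v : V) (gs : List (Gate k σ)) : List (Gate k σ) × Operand k σ :=
  slc gs (((bc v).1, Operand.const 1, (bc v).2) ::
    L.map fun w => (-(Nc v w).1, hy w, (Nc v w).2))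

/-- One round over the list `l` of coordinates still to be computed; returns the extended program
and the new handles (junk `const 0` off `l`). [cite: MalodPortier2008, Prop. 5 (proof)] -/
def roundL (Nc : V → V → k × Operand k σ) (bc : V → k × Operand k σ) (L : List V)
    (hy : V → Operand k σ) : List V → List (Gate k σ) → List (Gate k σ) × (V → Operand k σ)
  | [], gs => (gs, fun _ => .const 0)
  | v :: rest, gs =>
    ((roundL Nc bc L hy rest (vstep Nc bc L hy v gs).1).1,
      fun w => if w = v then (vstep Nc bc L hy v gs).2
        else (roundL Nc bc L hy rest (vstep Nc bc L hy v gs).1).2 w)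

/-- `r` rounds, starting from the zero vector (all handles `const 0`) and the empty program.
[cite: MalodPortier2008, Prop. 5 (proof)] -/
def rounds (Nc : V → V → k × Operand k σ) (bc : V → k × Operand k σ) (L : List V) :
    ℕ → List (Gate k σ) × (V → Operand k σ)
  | 0 => ([], fun _ => .const 0)
  | r + 1 => roundL Nc bc L (rounds Nc bc L r).2 L (rounds Nc bc L r).1

/-- The whole circuit: `m` rounds, then the signed linear combination `∑_v a_v y_v`.
[cite: MalodPortier2008, Prop. 5 (proof)] -/
def abpCircuit (Nc : V → V → k × Operand k σ) (bc ac : V → k × Operand k σ) (L : List V)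
    (m : ℕ) : ArithCircuit k σ where
  gates := (slc (rounds Nc bc L m).1 (L.map fun v => ((ac v).1, (rounds Nc bc L m).2 v, (ac v).2))).1
  output := (slc (rounds Nc bc L m).1 (L.map fun v => ((ac v).1, (rounds Nc bc L m).2 v, (ac v).2))).2

/-- The chosen representations are sign constants and inputs.
[cite: MalodPortier2008, Prop. 5 (proof)] -/
def ReprOk (p : k × Operand k σ) : Prop := IsSignConstant p.1 ∧ IsInput p.2

/-- The weight represented by `(c, a)`. [folklore] -/
def reprVal (p : k × Operand k σ) : MvPolynomial σ k := p.1 • ival p.2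

/-- Unfolding `roundL` on the empty list. [folklore] -/
private theorem roundL_nil (Nc : V → V → k × Operand k σ) (bc : V → k × Operand k σ) (L : List V)
    (hy : V → Operand k σ) (gs : List (Gate k σ)) :
    roundL Nc bc L hy [] gs = (gs, fun _ => .const 0) := rfl

/-- Unfolding `roundL` on a nonempty list. [folklore] -/
private theorem roundL_cons (Nc : V → V → k × Operand k σ) (bc : V → k × Operand k σ) (L : List V)
    (hy : V → Operand k σ) (v : V) (rest : List V) (gs : List (Gate k σ)) :
    roundL Nc bc L hy (v :: rest) gs =
      ((roundL Nc bc L hy rest (vstep Nc bc L hy v gs).1).1,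
        fun w => if w = v then (vstep Nc bc L hy v gs).2
          else (roundL Nc bc L hy rest (vstep Nc bc L hy v gs).1).2 w) := rfl

/-- Unfolding `rounds 0`. [folklore] -/
private theorem rounds_zero (Nc : V → V → k × Operand k σ) (bc : V → k × Operand k σ) (L : List V) :
    rounds Nc bc L 0 = ([], fun _ => .const 0) := rfl

/-- Unfolding `rounds (r+1)`. [folklore] -/
private theorem rounds_succ (Nc : V → V → k × Operand k σ) (bc : V → k × Operand k σ) (L : List V)
    (r : ℕ) :
    rounds Nc bc L (r + 1) = roundL Nc bc L (rounds Nc bc L r).2 L (rounds Nc bc L r).1 := rfl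

omit [DecidableEq V] in
/-- **One coordinate**: `vstep` extends the program by `2(|L|+1)+1` good gates and its handle
reads `b_v − ∑_{w∈L} N_{vw} · y_w`. [cite: MalodPortier2008, Prop. 5 (proof)] -/
theorem vstep_spec {Nc : V → V → k × Operand k σ} {bc : V → k × Operand k σ}
    (hNc : ∀ v w, ReprOk (Nc v w)) (hbc : ∀ v, ReprOk (bc v)) (L : List V)
    {hy : V → Operand k σ} {y : V → MvPolynomial σ k} {gs : List (Gate k σ)} (hgs : Good gs)
    (hok : ∀ w, HOk gs (hy w)) (hyv : ∀ w, hval gs (hy w) = y w) (v : V) :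
    gs <+: (vstep Nc bc L hy v gs).1 ∧ Good (vstep Nc bc L hy v gs).1 ∧
      HOk (vstep Nc bc L hy v gs).1 (vstep Nc bc L hy v gs).2 ∧
      hval (vstep Nc bc L hy v gs).1 (vstep Nc bc L hy v gs).2 =
        reprVal (bc v) - (L.map fun w => reprVal (Nc v w) * y w).sum ∧
      (vstep Nc bc L hy v gs).1.length = gs.length + 2 * (L.length + 1) + 1 := by
  have hts : TermsOk gs (((bc v).1, Operand.const 1, (bc v).2) ::
      L.map fun w => (-(Nc v w).1, hy w, (Nc v w).2)) := by
    intro t ht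
    rw [List.mem_cons, List.mem_map] at ht
    rcases ht with rfl | ⟨w, -, rfl⟩
    · exact ⟨(hbc v).1, ⟨trivial, isSignConstant_one⟩, (hbc v).2⟩
    · exact ⟨isSignConstant_neg (hNc v w).1, hok w, (hNc v w).2⟩
  obtain ⟨h1, h2, h3, h4, h5⟩ := slc_spec hgs _ hts
  unfold vstep
  refine ⟨h1, h2, h3, ?_, by rw [h5]; simp⟩
  rw [h4, List.map_cons, List.sum_cons, List.map_map]
  have hb : termVal gs ((bc v).1, Operand.const 1, (bc v).2) = reprVal (bc v) := by
    simp only [termVal, reprVal]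
    rw [hval_eq_ival (hbc v).2.1]
    simp [hval, Operand.eval]
  have hN : ∀ w, termVal gs (-(Nc v w).1, hy w, (Nc v w).2) = -(reprVal (Nc v w) * y w) := by
    intro w
    simp only [termVal, reprVal, smul_eq_C_mul, map_neg]
    rw [hyv w, hval_eq_ival (hNc v w).2.1]
    ring
  rw [hb, sub_eq_add_neg, ← list_sum_map_neg]
  congr 2
  exact List.map_congr_left fun w _ => hN w

/-- **One round**: after `roundL … l gs`, every coordinate `w ∈ l` has a usable handle reading
`b_w − ∑_{u∈L} N_{wu} y_u`, the other handles are `const 0`, and the program grew by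
`|l| (2(|L|+1)+1)` good gates. [cite: MalodPortier2008, Prop. 5 (proof)] -/
theorem roundL_spec {Nc : V → V → k × Operand k σ} {bc : V → k × Operand k σ}
    (hNc : ∀ v w, ReprOk (Nc v w)) (hbc : ∀ v, ReprOk (bc v)) (L : List V)
    {hy : V → Operand k σ} {y : V → MvPolynomial σ k} :
    ∀ (l : List V) {gs : List (Gate k σ)}, Good gs → (∀ w, HOk gs (hy w)) →
      (∀ w, hval gs (hy w) = y w) →
      gs <+: (roundL Nc bc L hy l gs).1 ∧ Good (roundL Nc bc L hy l gs).1 ∧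
        (∀ w, HOk (roundL Nc bc L hy l gs).1 ((roundL Nc bc L hy l gs).2 w)) ∧
        (∀ w ∈ l, hval (roundL Nc bc L hy l gs).1 ((roundL Nc bc L hy l gs).2 w) =
          reprVal (bc w) - (L.map fun u => reprVal (Nc w u) * y u).sum) ∧
        (roundL Nc bc L hy l gs).1.length = gs.length + l.length * (2 * (L.length + 1) + 1)
  | [], gs, hgs, _, _ => by
    rw [roundL_nil]
    refine ⟨List.prefix_rfl, hgs, fun w => ⟨trivial, isSignConstant_zero⟩, fun w hw => ?_, by simp⟩
    simp at hw
  | v :: rest, gs, hgs, hok, hyv => by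
    rw [roundL_cons]
    obtain ⟨p1, g1, ok1, v1, len1⟩ := vstep_spec hNc hbc L hgs hok hyv v
    have hok' : ∀ w, HOk (vstep Nc bc L hy v gs).1 (hy w) := fun w => (hok w).mono p1.length_le
    have hyv' : ∀ w, hval (vstep Nc bc L hy v gs).1 (hy w) = y w := fun w => by
      rw [hval_of_prefix p1 (hok w).1, hyv w]
    obtain ⟨p2, g2, ok2, v2, len2⟩ := roundL_spec hNc hbc L rest g1 hok' hyv'
    refine ⟨p1.trans p2, g2, fun w => ?_, fun w hw => ?_, ?_⟩
    · dsimp only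
      split_ifs
      · exact ok1.mono p2.length_le
      · exact ok2 w
    · dsimp only
      split_ifs with hwv
      · subst hwv
        rw [hval_of_prefix p2 ok1.1, v1]
      · exact v2 w ((List.mem_cons.1 hw).resolve_left hwv)
    · dsimp only
      rw [len2, len1, List.length_cons]
      ring

variable [Fintype V]

/-- `∑_{j<r+1} (−N)^j = 1 − N · ∑_{j<r} (−N)^j`. [folklore] -/
private theorem geomInv_succ (N : Matrix V V (MvPolynomial σ k)) (r : ℕ) :
    GKKP2011.geomInv N (r + 1) = 1 - N * GKKP2011.geomInv N r := by
  unfold GKKP2011.geomInv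
  rw [Finset.sum_range_succ', pow_zero, Finset.mul_sum, sub_eq_add_neg, add_comm,
    ← Finset.sum_neg_distrib]
  congr 1
  refine Finset.sum_congr rfl fun j _ => ?_
  rw [pow_succ', neg_mul]

/-- **All rounds**: after `r` rounds every coordinate has a usable handle reading
`((∑_{j<r} (−N)^j) b)_w`, and the program has `r |V| (2(|V|+1)+1)` good gates.
[cite: MalodPortier2008, Prop. 5 (proof)] -/
theorem rounds_spec {Nc : V → V → k × Operand k σ} {bc : V → k × Operand k σ}
    (hNc : ∀ v w, ReprOk (Nc v w)) (hbc : ∀ v, ReprOk (bc v))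
    (N : Matrix V V (MvPolynomial σ k)) (b : V → MvPolynomial σ k)
    (hN : ∀ v w, N v w = reprVal (Nc v w)) (hb : ∀ v, b v = reprVal (bc v)) :
    ∀ r : ℕ, Good (rounds Nc bc univ.toList r).1 ∧
      (∀ w, HOk (rounds Nc bc univ.toList r).1 ((rounds Nc bc univ.toList r).2 w)) ∧
      (∀ w, hval (rounds Nc bc univ.toList r).1 ((rounds Nc bc univ.toList r).2 w) =
        (GKKP2011.geomInv N r).mulVec b w) ∧
      (rounds Nc bc univ.toList r).1.length =
        r * (Fintype.card V * (2 * (Fintype.card V + 1) + 1))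
  | 0 => by
    rw [rounds_zero]
    refine ⟨good_nil, fun w => ⟨trivial, isSignConstant_zero⟩, fun w => ?_, by simp⟩
    simp [hval, Operand.eval, GKKP2011.geomInv]
  | r + 1 => by
    rw [rounds_succ]
    obtain ⟨g0, ok0, v0, len0⟩ := rounds_spec hNc hbc N b hN hb r
    obtain ⟨-, g1, ok1, v1, len1⟩ := roundL_spec hNc hbc univ.toList univ.toList g0 ok0 v0
    have hmv : ∀ (z : V → MvPolynomial σ k) (w : V),
        N.mulVec z w = ∑ u, reprVal (Nc w u) * z u := fun z w => by
      simp only [Matrix.mulVec, dotProduct, hN]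
    refine ⟨g1, ok1, fun w => ?_, ?_⟩
    · rw [v1 w (Finset.mem_toList.2 (Finset.mem_univ w)), geomInv_succ, Matrix.sub_mulVec,
        Matrix.one_mulVec, ← Matrix.mulVec_mulVec, Pi.sub_apply, hb w, hmv, Finset.sum_map_toList]
    · rw [len1, len0, Finset.length_toList, Finset.card_univ]
      ring

/-- **The circuit of a branching program**: fan-in two, constant-free, skew, computing
`a · (∑_{j<m} (−N)^j) · b`, of size `≤ (m+1)(2|V|+3)²`. [cite: MalodPortier2008, Prop. 5 (proof)] -/
theorem abpCircuit_spec {Nc : V → V → k × Operand k σ} {bc ac : V → k × Operand k σ}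
    (hNc : ∀ v w, ReprOk (Nc v w)) (hbc : ∀ v, ReprOk (bc v)) (hac : ∀ v, ReprOk (ac v))
    (N : Matrix V V (MvPolynomial σ k)) (a b : V → MvPolynomial σ k)
    (hN : ∀ v w, N v w = reprVal (Nc v w)) (ha : ∀ v, a v = reprVal (ac v))
    (hb : ∀ v, b v = reprVal (bc v)) (m : ℕ) :
    (abpCircuit Nc bc ac univ.toList m).IsFanInTwo ∧
      (abpCircuit Nc bc ac univ.toList m).HasSignConstants ∧
      (abpCircuit Nc bc ac univ.toList m).IsSkew ∧
      (abpCircuit Nc bc ac univ.toList m).eval = a ⬝ᵥ (GKKP2011.geomInv N m).mulVec b ∧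
      (abpCircuit Nc bc ac univ.toList m).size ≤ (m + 1) * (2 * Fintype.card V + 3) ^ 2 := by
  obtain ⟨g0, ok0, v0, len0⟩ := rounds_spec hNc hbc N b hN hb m
  have hts : TermsOk (rounds Nc bc univ.toList m).1
      (univ.toList.map fun v => ((ac v).1, (rounds Nc bc univ.toList m).2 v, (ac v).2)) := by
    intro t ht
    rw [List.mem_map] at ht
    obtain ⟨v, -, rfl⟩ := ht
    exact ⟨(hac v).1, ok0 v, (hac v).2⟩
  obtain ⟨-, g1, ok1, v1, len1⟩ := slc_spec g0 _ hts
  refine ⟨fun g hg => (g1 g hg).1, ⟨fun g hg => (g1 g hg).2.1, ok1.2⟩, fun g hg => (g1 g hg).2.2,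
    ?_, ?_⟩
  · change hval (slc (rounds Nc bc univ.toList m).1 _).1 (slc (rounds Nc bc univ.toList m).1 _).2 = _
    rw [v1, List.map_map, Finset.sum_map_toList]
    unfold dotProduct
    refine Finset.sum_congr rfl fun v _ => ?_
    simp only [Function.comp_apply, termVal, smul_eq_C_mul]
    rw [v0 v, hval_eq_ival (hac v).2.1, ha v, reprVal, smul_eq_C_mul]
    ring
  · change (slc _ _).1.length ≤ _
    rw [len1, len0, List.length_map, Finset.length_toList, Finset.card_univ]
    have h1 : Fintype.card V * (2 * (Fintype.card V + 1) + 1) ≤ (2 * Fintype.card V + 3) ^ 2 := by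
      nlinarith [Nat.zero_le (Fintype.card V)]
    have h2 : 2 * Fintype.card V + 1 ≤ (2 * Fintype.card V + 3) ^ 2 := by
      nlinarith [Nat.zero_le (Fintype.card V)]
    calc m * (Fintype.card V * (2 * (Fintype.card V + 1) + 1)) + 2 * Fintype.card V + 1
        ≤ m * (2 * Fintype.card V + 3) ^ 2 + (2 * Fintype.card V + 3) ^ 2 := by
          have := Nat.mul_le_mul_left m h1
          omega
      _ = (m + 1) * (2 * Fintype.card V + 3) ^ 2 := by ring

/-- **From a branching program with weights in `{X_i, 0, 1, −1}` to a constant-free skew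
circuit** computing `a · (∑_{j<m} (−N)^j) · b` (for a nilpotent layered `N` and `m` large this
is the value `a · (1+N)⁻¹ · b` of the program), of size `≤ (m+1)(2|V|+3)²` (Malod–Portier 2008,
proof of Prop. 5: iterated products of matrices with input entries are weakly skew / skew
computations; Toda 1992, Lemma 3.4). [cite: MalodPortier2008, Prop. 5 (proof)] -/
theorem exists_skewCircuit_dotProduct (N : Matrix V V (MvPolynomial σ k))
    (a b : V → MvPolynomial σ k) (m : ℕ) (hN : ∀ v w, IsSInput (N v w))
    (ha : ∀ v, IsSInput (a v)) (hb : ∀ v, IsSInput (b v)) :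
    ∃ P : ArithCircuit k σ, P.IsFanInTwo ∧ P.HasSignConstants ∧ P.IsSkew ∧
      P.eval = a ⬝ᵥ (GKKP2011.geomInv N m).mulVec b ∧
      P.size ≤ (m + 1) * (2 * Fintype.card V + 3) ^ 2 := by
  choose Nc hNc1 hNc2 hNc3 using fun v w => (hN v w).exists_repr
  choose bc hbc1 hbc2 hbc3 using fun v => (hb v).exists_repr
  choose ac hac1 hac2 hac3 using fun v => (ha v).exists_repr
  exact ⟨abpCircuit Nc bc ac univ.toList m,
    abpCircuit_spec (fun v w => ⟨hNc1 v w, hNc2 v w⟩) (fun v => ⟨hbc1 v, hbc2 v⟩)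
      (fun v => ⟨hac1 v, hac2 v⟩) N a b hNc3 hac3 hbc3 m⟩

end Program

/-! ## Part C. The determinant: `DET^0 ⊆ VP_s^0` -/

section Det

variable (k : Type u) [CommRing k]

variable {σ : Type v} in
/-- `0` is admissible. [folklore] -/
private theorem isSInput_zero : IsSInput (0 : MvPolynomial σ k) := Or.inl rfl

/-- The entries `xvar` (a variable or `0`) are admissible. [folklore] -/
private theorem isSInput_xvar (n a b : ℕ) : IsSInput (Berkowitz.xvar k n a b) := by
  unfold Berkowitz.xvar
  split_ifs
  · exact Or.inr (Or.inr (Or.inr ⟨_, rfl⟩))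
  · exact Or.inl rfl

/-- The edge weights of the Mahajan–Vinay program are admissible. [cite: MahajanVinay1997, §3] -/
theorem isSInput_stepWp (n f t' u' : ℕ) (π π' : Bool) :
    IsSInput (GKKP2011.stepWp k n f t' u' π π') := by
  unfold GKKP2011.stepWp
  split_ifs <;> first | exact isSInput_xvar k _ _ _ | exact Or.inl rfl

/-- The transfer matrix entries are admissible. [cite: MahajanVinay1997, §3] -/
theorem isSInput_Tp (n : ℕ) (s s' : (Fin n × Fin n) × Bool) :
    IsSInput (GKKP2011.Tp k n s s') := by
  unfold GKKP2011.Tp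
  rw [Matrix.of_apply]
  split_ifs <;> first | exact isSInput_stepWp k .. | exact Or.inl rfl

/-- The internal weights of the determinant program are admissible.
[cite: GrenetEtAl2011, Thm 5 (proof)] -/
theorem isSInput_bigN (n : ℕ) (v v' : GKKP2011.Vtx n) : IsSInput (GKKP2011.bigN k n v v') := by
  rcases v with p | π <;> rcases v' with p' | π'
  · rw [GKKP2011.bigN_inl_inl]
    split_ifs
    · exact isSInput_Tp k ..
    · exact Or.inl rfl
  · rw [GKKP2011.bigN_inl_inr]
    split_ifs
    · exact Or.inr (Or.inl rfl)
    · exact Or.inl rfl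
  · rw [GKKP2011.bigN_inr]
    exact Or.inl rfl
  · rw [GKKP2011.bigN_inr]
    exact Or.inl rfl

/-- The source weights of the determinant program are admissible.
[cite: GrenetEtAl2011, Thm 5 (proof)] -/
theorem isSInput_srcVec (n : ℕ) (v : GKKP2011.Vtx n) : IsSInput (GKKP2011.srcVec k n v) := by
  rcases v with p | π
  · simp only [GKKP2011.srcVec, Sum.elim_inl]
    split_ifs
    · exact isSInput_stepWp k ..
    · exact Or.inl rfl
  · exact Or.inl rfl

/-- The sink weights of the determinant program are admissible.
[cite: GrenetEtAl2011, Thm 5 (proof)] -/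
theorem isSInput_snkVec (n : ℕ) (v : GKKP2011.Vtx n) : IsSInput (GKKP2011.snkVec k n v) := by
  rcases v with p | π
  · exact Or.inl rfl
  · simp only [GKKP2011.snkVec, Sum.elim_inr, GKKP2011.sgnB]
    split_ifs
    · exact Or.inr (Or.inr (Or.inl rfl))
    · exact Or.inr (Or.inl rfl)

/-- The number of internal vertices of the determinant program: `2n³ + 2`.
[cite: GrenetEtAl2011, Thm 5 (proof)] -/
theorem card_vtx (n : ℕ) : Fintype.card (GKKP2011.Vtx n) = 2 * n ^ 3 + 2 := by
  simp only [Fintype.card_sum, Fintype.card_prod, Fintype.card_fin, Fintype.card_bool]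
  ring

/-- **A constant-free skew circuit for the generic determinant** (Toda 1992, Lemma 3.4;
Malod–Portier 2008, Prop. 5), over every commutative ring, of size `≤ (n+2)(4n³+7)²`: the
tree's branching program `GKKP2011.bigN/srcVec/snkVec` (`GKKP2011.abpValue_eq_detPoly`) through
`exists_skewCircuit_dotProduct`. [cite: MalodPortier2008, Prop. 5] -/
theorem exists_skewCircuit_detPoly (n : ℕ) :
    ∃ P : ArithCircuit k (Fin n × Fin n), P.IsFanInTwo ∧ P.HasSignConstants ∧ P.IsSkew ∧
      P.eval = detPoly (Fin n) k ∧ P.size ≤ (n + 2) * (4 * n ^ 3 + 7) ^ 2 := by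
  rcases Nat.eq_zero_or_pos n with rfl | hn
  · refine ⟨ArithCircuit.ofConst 1, fun g hg => by simp [ArithCircuit.ofConst] at hg,
      ⟨fun g hg => by simp [ArithCircuit.ofConst] at hg, isSignConstant_one⟩,
      fun g hg => by simp [ArithCircuit.ofConst] at hg, ?_, by simp [ArithCircuit.ofConst, size]⟩
    rw [ArithCircuit.eval_ofConst, map_one, detPoly]
    exact (Matrix.det_isEmpty).symm
  · obtain ⟨P, h1, h2, h3, h4, h5⟩ := exists_skewCircuit_dotProduct (GKKP2011.bigN k n)
      (GKKP2011.srcVec k n) (GKKP2011.snkVec k n) (n + 1) (isSInput_bigN k n)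
      (isSInput_srcVec k n) (isSInput_snkVec k n)
    refine ⟨P, h1, h2, h3, ?_, ?_⟩
    · rw [h4, ← GKKP2011.abpValue_eq_detPoly (k := k) (n := n) hn.ne']
      rfl
    · rw [card_vtx] at h5
      calc P.size ≤ (n + 1 + 1) * (2 * (2 * n ^ 3 + 2) + 3) ^ 2 := h5
        _ = (n + 2) * (4 * n ^ 3 + 7) ^ 2 := by ring

end Det

/-! ### Substituting the entries of a binary variable matrix -/

section Subst

variable {k : Type u} [CommRing k] {σ : Type v} {τ : Type w}

/-- An input evaluates to `ival`, whatever the value list. [folklore] -/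
private theorem eval_input {a : Operand k τ} (ha : a.isGateRef = false) (vals : List (MvPolynomial τ k)) :
    a.eval vals = ival a := by
  cases a with
  | var i => rfl
  | const c => rfl
  | gate j => simp [Operand.isGateRef] at ha

omit [CommRing k] in
/-- Substituting inputs for inputs keeps a circuit skew. [folklore] -/
private theorem isSkew_substCircuit_nil {P : ArithCircuit k σ} (hP : P.IsSkew) {ρ : σ → Operand k τ}
    (hρ : ∀ i, (ρ i).isGateRef = false) : (P.substCircuit [] ρ).IsSkew := by
  intro g hg
  simp only [ArithCircuit.substCircuit, List.nil_append, List.mem_map] at hg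
  obtain ⟨g', hg', rfl⟩ := hg
  have hsk := hP g' hg'
  cases g' with
  | sum args => trivial
  | prod args =>
    show (args.map (Operand.subst ρ _)).countP Operand.isGateRef ≤ 1
    rw [List.countP_map]
    have : args.countP (Operand.isGateRef ∘ Operand.subst ρ ([] : List (Gate k τ)).length) =
        args.countP Operand.isGateRef :=
      List.countP_congr fun u _ => by
        cases u with
        | var i =>
          show (Operand.isGateRef (ρ i) = true) ↔ (false = true)
          rw [hρ i]
        | const c => exact Iff.rfl
        | gate j => exact Iff.rfl
    rw [this]
    exact hsk

/-- **`DET^0 ⊆ VP_s^0` for one polynomial**: a binary variable matrix of size `s` with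
determinant `f` yields a fan-in-two constant-free skew circuit for `f` of size
`≤ (s+2)(4s³+7)²` (substitute the entries `0, 1, X_v` for the inputs of the determinant circuit).
[cite: HuttenhainIkenmeyer2016, Prop. 5.2 (proof)] -/
theorem exists_skewCircuit_of_hasBinaryDetRepr {f : MvPolynomial τ ℤ} {s : ℕ}
    (hf : HasBinaryDetRepr f s) :
    ∃ P : ArithCircuit ℤ τ, P.IsFanInTwo ∧ P.HasSignConstants ∧ P.IsSkew ∧ P.eval = f ∧
      P.size ≤ (s + 2) * (4 * s ^ 3 + 7) ^ 2 := by
  obtain ⟨A, hA, hdet⟩ := hf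
  obtain ⟨D, h1, h2, h3, h4, h5⟩ := exists_skewCircuit_detPoly ℤ s
  have hρ : ∀ ij : Fin s × Fin s, ∃ o : Operand ℤ τ, IsInput o ∧ ival o = A ij.1 ij.2 := by
    intro ij
    rcases hA ij.1 ij.2 with h | h | ⟨v, h⟩
    · exact ⟨.const 0, ⟨rfl, isSignConstant_zero⟩, by rw [h]; simp [ival, Operand.eval]⟩
    · exact ⟨.const 1, ⟨rfl, isSignConstant_one⟩, by rw [h]; simp [ival, Operand.eval]⟩
    · exact ⟨.var v, ⟨rfl, trivial⟩, by rw [h]; rfl⟩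
  choose ρ hρi hρv using hρ
  refine ⟨D.substCircuit [] ρ, h1.substCircuit (by simp) ρ,
    h2.substCircuit (by simp) (fun i => (hρi i).2), isSkew_substCircuit_nil h3 (fun i => (hρi i).1),
    ?_, by rw [ArithCircuit.size_substCircuit, List.length_nil, zero_add]; exact h5⟩
  rw [ArithCircuit.eval_substCircuit D [] (h := fun ij => A ij.1 ij.2)
      (fun i ws => by rw [eval_input (hρi i).1, hρv i]),
    h4, detPoly, AlgHom.map_det, Matrix.mvPolynomialX_mapMatrix_aeval, hdet]

/-- **`DET^0 ⊆ VP_s^0`** (Hüttenhain–Ikenmeyer 2016, Prop. 5.2, first inclusion: "[Tod92,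
Lemma 3.4] immediately shows that `DET^0 ⊆ VP_s^0`"). [cite: HuttenhainIkenmeyer2016, Prop. 5.2] -/
theorem isVPsZeroFamily_of_isDETZeroFamily {ς : ℕ → Type w} {f : ∀ n, MvPolynomial (ς n) ℤ}
    (hf : IsDETZeroFamily f) : IsVPsZeroFamily f := by
  obtain ⟨s, hs, hA⟩ := hf
  choose P h1 h2 h3 h4 h5 using fun n => exists_skewCircuit_of_hasBinaryDetRepr (hA n)
  refine ⟨P, fun n => ⟨h1 n, h2 n, h3 n, h4 n⟩, ?_⟩
  have hpoly : IsPBounded fun m => (m + 2) * (4 * m ^ 3 + 7) ^ 2 :=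
    IsPBounded.mul_holds (IsPBounded.add_holds IsPBounded.id (IsPBounded.const 2))
      (IsPBounded.pow_holds (IsPBounded.add_holds (IsPBounded.mul_holds (IsPBounded.const 4)
        (IsPBounded.pow_holds IsPBounded.id 3)) (IsPBounded.const 7)) 2)
  exact (IsPBounded.comp_holds hpoly hs).mono h5

end Subst

/-! ## Part D. From a skew circuit to a digraph: `VP_s^0 ⊆ DET^0` -/

section Digraph

variable {k : Type u} [CommRing k] {τ : Type v}

/-- The vertices of the digraph of a circuit with `s` gates: the source `s`, the target `t`, one
vertex per gate and two "middle" vertices per gate (one per operand slot).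
[cite: MalodPortier2008, Lemma 5] -/
abbrev TV (s : ℕ) : Type := (Unit ⊕ Unit) ⊕ (Fin s ⊕ Fin s × Fin 2)

/-- The source. [cite: MalodPortier2008, Lemma 5] -/
abbrev vS {s : ℕ} : TV s := Sum.inl (Sum.inl ())

/-- The target. [cite: MalodPortier2008, Lemma 5] -/
abbrev vT {s : ℕ} : TV s := Sum.inl (Sum.inr ())

/-- The vertex of gate `i`. [cite: MalodPortier2008, Lemma 5] -/
abbrev vG {s : ℕ} (i : Fin s) : TV s := Sum.inr (Sum.inl i)

/-- The middle vertex of operand slot `e` of gate `i`. [cite: MalodPortier2008, Lemma 5] -/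
abbrev vM {s : ℕ} (i : Fin s) (e : Fin 2) : TV s := Sum.inr (Sum.inr (i, e))

/-- `|TV s| = 3s + 2`. [folklore] -/
private theorem card_TV (s : ℕ) : Fintype.card (TV s) = 3 * s + 2 := by
  simp only [Fintype.card_sum, Fintype.card_unit, Fintype.card_prod, Fintype.card_fin]
  ring

/-- The ranking: source `0`, middles of gate `i` at `2i+1`, gate `i` at `2i+2`, target `2s+1`.
[folklore] -/
def rk {s : ℕ} : TV s → ℕ
  | Sum.inl (Sum.inl _) => 0
  | Sum.inl (Sum.inr _) => 2 * s + 1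
  | Sum.inr (Sum.inl i) => 2 * i + 2
  | Sum.inr (Sum.inr p) => 2 * p.1 + 1

/-- All ranks are `< |TV s|`. [folklore] -/
private theorem rk_lt_card {s : ℕ} (v : TV s) : rk v < Fintype.card (TV s) := by
  rw [card_TV]
  rcases v with (_ | _) | (i | ⟨i, e⟩) <;> simp only [rk] <;> omega

variable (P : ArithCircuit k τ)

/-- The tail vertex of the 2-arc path of an operand, as seen by gate `i`: the source for inputs
and junk references, the vertex of gate `j` for a reference `gate j`, `j < i`.
[cite: MalodPortier2008, Lemma 5] -/
def opSrc (i : ℕ) : Operand k τ → TV P.size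
  | .gate j => if h : j < i ∧ j < P.size then vG ⟨j, h.2⟩ else vS
  | _ => vS

/-- The label carried by an operand: its input (`X x`, `C c`), `1` for a live gate reference,
`0` for a junk reference. [cite: MalodPortier2008, Lemma 5] -/
def opLab (i : ℕ) : Operand k τ → MvPolynomial τ k
  | .var x => X x
  | .const c => C c
  | .gate j => if j < i ∧ j < P.size then 1 else 0

/-- The operand slots of a gate: pairs (tail operand, out-label operand). A sum `∑ c • u`
contributes `(u, const c)` per summand; a product `u₁ u₂` (skew: at most one gate reference)
contributes `(the gate reference or u₂, the other operand)`; the empty product `(1, 1)`.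
[cite: MalodPortier2008, Lemma 5] -/
def slots : Gate k τ → List (Operand k τ × Operand k τ)
  | .sum args => args.map fun a => (a.2, Operand.const a.1)
  | .prod [] => [(Operand.const 1, Operand.const 1)]
  | .prod [u] => [(u, Operand.const 1)]
  | .prod [u₁, u₂] => if u₁.isGateRef then [(u₁, u₂)] else [(u₂, u₁)]
  | .prod (_ :: _ :: _ :: _) => []

/-- Slot `e ∈ {0, 1}` of gate `i` (if present). [cite: MalodPortier2008, Lemma 5] -/
def slot (i : Fin P.size) (e : Fin 2) : Option (Operand k τ × Operand k τ) :=
  (slots (P.gates.getD i (Gate.sum [])))[e.1]?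

/-- Tail vertex of the first arc of slot `e` of gate `i`. [cite: MalodPortier2008, Lemma 5] -/
def inSrc (i : Fin P.size) (e : Fin 2) : TV P.size :=
  match slot P i e with
  | none => vS
  | some d => opSrc P i d.1

/-- Label of the first arc of slot `e` of gate `i` (`0` = no arc). [cite: MalodPortier2008, Lemma 5] -/
def inLab (i : Fin P.size) (e : Fin 2) : MvPolynomial τ k :=
  match slot P i e with
  | none => 0
  | some d => opLab P i d.1

/-- Label of the second arc (middle vertex → gate vertex) of slot `e` of gate `i`.
[cite: MalodPortier2008, Lemma 5] -/
def outLab (i : Fin P.size) (e : Fin 2) : MvPolynomial τ k :=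
  match slot P i e with
  | none => 0
  | some d => opLab P i d.2

/-- **The digraph of a skew circuit** as its adjacency (label) matrix: the 2-arc paths of the
operand slots, and one final arc from the output's tail vertex into the target.
[cite: MalodPortier2008, Lemma 5] -/
def todaE : Matrix (TV P.size) (TV P.size) (MvPolynomial τ k) :=
  Matrix.of fun u v =>
    match v with
    | Sum.inl (Sum.inl _) => 0
    | Sum.inl (Sum.inr _) => if u = opSrc P P.size P.output then opLab P P.size P.output else 0
    | Sum.inr (Sum.inl i) =>
      (match u with
        | Sum.inr (Sum.inr p) => if p.1 = i then outLab P i p.2 else 0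
        | _ => 0)
    | Sum.inr (Sum.inr p) => if u = inSrc P p.1 p.2 then inLab P p.1 p.2 else 0

/-- No arcs into the source. [folklore] -/
@[simp] private theorem todaE_vS (u : TV P.size) : todaE P u vS = 0 := rfl

/-- Arcs into the target. [folklore] -/
private theorem todaE_vT (u : TV P.size) :
    todaE P u vT = if u = opSrc P P.size P.output then opLab P P.size P.output else 0 := rfl

/-- Arcs into a middle vertex. [folklore] -/
private theorem todaE_vM (u : TV P.size) (i : Fin P.size) (e : Fin 2) :
    todaE P u (vM i e) = if u = inSrc P i e then inLab P i e else 0 := rfl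

/-- Arcs middle → gate. [folklore] -/
@[simp] private theorem todaE_vM_vG (i' : Fin P.size) (e : Fin 2) (i : Fin P.size) :
    todaE P (vM i' e) (vG i) = if i' = i then outLab P i e else 0 := rfl

/-- No arcs source/target → gate. [folklore] -/
@[simp] private theorem todaE_inl_vG (x : Unit ⊕ Unit) (i : Fin P.size) :
    todaE P (Sum.inl x) (vG i) = 0 := by
  rcases x with _ | _ <;> rfl

/-- No arcs gate → gate. [folklore] -/
@[simp] private theorem todaE_vG_vG (j i : Fin P.size) : todaE P (vG j) (vG i) = 0 := rfl

omit [CommRing k] in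
/-- Tail vertices of operands seen by gate `i` have rank `≤ 2i`. [folklore] -/
private theorem rk_opSrc_le (i : ℕ) (u : Operand k τ) : rk (opSrc P i u) ≤ 2 * i := by
  cases u with
  | var x => simp [opSrc, rk]
  | const c => simp [opSrc, rk]
  | gate j =>
    simp only [opSrc]
    split_ifs with h
    · simp only [rk]
      omega
    · simp [rk]

/-- Tail vertices of the slots of gate `i` have rank `≤ 2i`. [folklore] -/
private theorem rk_inSrc_le (i : Fin P.size) (e : Fin 2) : rk (inSrc P i e) ≤ 2 * i := by
  unfold inSrc
  cases slot P i e with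
  | none => simp [rk]
  | some d => exact rk_opSrc_le P i d.1

/-- **The digraph is acyclic**: `rk` increases strictly along every arc. [folklore] -/
private theorem todaE_ranked : ∀ u v, todaE P u v ≠ 0 → rk u < rk v := by
  intro u v h
  rcases v with (x | x) | (i | ⟨i, e⟩)
  · exact (h rfl).elim
  · have hu : u = opSrc P P.size P.output := by
      by_contra hne
      exact h (by rw [show (Sum.inl (Sum.inr x) : TV P.size) = vT from rfl, todaE_vT, if_neg hne])
    rw [hu]
    have := rk_opSrc_le P P.size P.output
    show rk (opSrc P P.size P.output) < 2 * P.size + 1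
    omega
  · rcases u with (y | y) | (j | ⟨i', e'⟩)
    · exact (h (todaE_inl_vG P _ i)).elim
    · exact (h (todaE_inl_vG P _ i)).elim
    · exact (h (todaE_vG_vG P j i)).elim
    · have hi : i' = i := by
        by_contra hne
        exact h (by rw [show (Sum.inr (Sum.inr (i', e')) : TV P.size) = vM i' e' from rfl,
          todaE_vM_vG, if_neg hne])
      subst hi
      simp only [rk]
      omega
  · have hu : u = inSrc P i e := by
      by_contra hne
      exact h (by rw [show (Sum.inr (Sum.inr (i, e)) : TV P.size) = vM i e from rfl, todaE_vM,
        if_neg hne])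
    rw [hu]
    have := rk_inSrc_le P i e
    show rk (inSrc P i e) < 2 * (i : ℕ) + 1
    omega

/-- No loops. [folklore] -/
private theorem todaE_apply_self (v : TV P.size) : todaE P v v = 0 := by
  by_contra h
  exact lt_irrefl _ (todaE_ranked P v v h)

/-- A ranked digraph with all ranks `< n` has `E ^ n = 0`. [folklore] -/
private theorem pow_eq_zero_of_ranked {V : Type*} [Fintype V] [DecidableEq V] {R : Type*} [CommRing R]
    {E : Matrix V V R} {rk : V → ℕ} (hrk : ∀ u v, E u v ≠ 0 → rk u < rk v) {n : ℕ}
    (hn : ∀ v, rk v < n) : E ^ n = 0 := by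
  have key : ∀ (ℓ : ℕ) (u v : V), (E ^ ℓ) u v ≠ 0 → rk u + ℓ ≤ rk v := by
    intro ℓ
    induction ℓ with
    | zero =>
      intro u v h
      rw [pow_zero] at h
      by_cases huv : u = v
      · subst huv
        simp
      · exact absurd (Matrix.one_apply_ne huv) h
    | succ ℓ ih =>
      intro u v h
      rw [pow_succ, Matrix.mul_apply] at h
      obtain ⟨w, -, hw⟩ := Finset.exists_ne_zero_of_sum_ne_zero h
      have h1 := ih u w (left_ne_zero_of_mul hw)
      have h2 := hrk w v (right_ne_zero_of_mul hw)
      omega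
  ext u v
  rw [Matrix.zero_apply]
  by_contra h
  have h1 := key n u v h
  have h2 := hn v
  omega

/-- **The path-value recursion** in an acyclic digraph: the signed path value into `v` is the
direct arc minus the signed path values into the in-neighbours times the last arc
(Hüttenhain–Ikenmeyer's sign convention `(−1)^{#arcs − 1}`). [cite: HuttenhainIkenmeyer2016, §2] -/
theorem pathValue_rec {V : Type*} [Fintype V] [DecidableEq V] {R : Type*} [CommRing R]
    {E : Matrix V V R} (hE : E ^ Fintype.card V = 0) (s v : V) :
    pathValue E s v = E s v - ∑ u, pathValue E s u * E u v := by
  set n := Fintype.card V with hn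
  have hstep : ∀ ℓ : ℕ, ∑ u, (E ^ (ℓ + 1)) s u * E u v = (E ^ (ℓ + 2)) s v := fun ℓ => by
    rw [pow_succ E (ℓ + 1), Matrix.mul_apply]
  have hsum : ∑ u, pathValue E s u * E u v =
      ∑ ℓ ∈ range n, (-1 : R) ^ ℓ * (E ^ (ℓ + 2)) s v := by
    simp only [pathValue, Finset.sum_mul]
    rw [Finset.sum_comm]
    refine Finset.sum_congr rfl fun ℓ _ => ?_
    rw [← hstep ℓ, Finset.mul_sum]
    exact Finset.sum_congr rfl fun u _ => mul_assoc _ _ _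
  have h3 : pathValue E s v = ∑ ℓ ∈ range (n + 1), (-1 : R) ^ ℓ * (E ^ (ℓ + 1)) s v := by
    rw [pathValue, Finset.sum_range_succ, pow_succ E n, hE, zero_mul, Matrix.zero_apply, mul_zero,
      add_zero]
  rw [hsum, h3, Finset.sum_range_succ', pow_zero, one_mul, zero_add, pow_one, sub_eq_add_neg,
    add_comm, ← Finset.sum_neg_distrib]
  congr 1
  refine Finset.sum_congr rfl fun ℓ _ => ?_
  rw [show ℓ + 1 + 1 = ℓ + 2 from rfl, pow_succ (-1 : R) ℓ]
  ring

/-- The signed path value from the source. [cite: HuttenhainIkenmeyer2016, §2] -/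
def W (u : TV P.size) : MvPolynomial τ k := pathValue (todaE P) vS u

/-- The value transported by a tail vertex: `1` for the source, `−W` for a gate vertex (all
source–gate paths have even length, hence sign `−1`). [folklore] -/
def sval (u : TV P.size) : MvPolynomial τ k := (if u = vS then 1 else 0) - W P u

/-- Nilpotency of the digraph matrix. [folklore] -/
private theorem todaE_pow_card : todaE P ^ Fintype.card (TV P.size) = 0 :=
  pow_eq_zero_of_ranked (todaE_ranked P) rk_lt_card

/-- The recursion for `W`. [folklore] -/
private theorem W_rec (v : TV P.size) : W P v = todaE P vS v - ∑ u, W P u * todaE P u v :=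
  pathValue_rec (todaE_pow_card P) vS v

/-- `W s = 0`. [folklore] -/
private theorem W_vS : W P vS = 0 := by
  rw [W_rec]
  simp

/-- `sval s = 1`. [folklore] -/
private theorem sval_vS : sval P vS = 1 := by
  simp [sval, W_vS]

/-- The path value into a middle vertex: first-arc label times the value of its tail.
[folklore] -/
private theorem W_vM (i : Fin P.size) (e : Fin 2) : W P (vM i e) = inLab P i e * sval P (inSrc P i e) := by
  rw [W_rec]
  simp only [todaE_vM, mul_ite, mul_zero, Finset.sum_ite_eq', Finset.mem_univ, if_true]
  unfold sval
  by_cases h : inSrc P i e = vS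
  · rw [h]
    simp [W_vS]
  · rw [if_neg (Ne.symm h), if_neg h]
    ring

/-- The path value into the target. [folklore] -/
private theorem W_vT : W P vT = opLab P P.size P.output * sval P (opSrc P P.size P.output) := by
  rw [W_rec]
  simp only [todaE_vT, mul_ite, mul_zero, Finset.sum_ite_eq', Finset.mem_univ, if_true]
  unfold sval
  by_cases h : opSrc P P.size P.output = vS
  · rw [h]
    simp [W_vS]
  · rw [if_neg (Ne.symm h), if_neg h]
    ring

/-- The path value into a gate vertex: minus the sum over its two slots. [folklore] -/
private theorem W_vG (i : Fin P.size) : W P (vG i) = -∑ e : Fin 2, W P (vM i e) * outLab P i e := by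
  rw [W_rec, show (vS : TV P.size) = Sum.inl (Sum.inl ()) from rfl, todaE_inl_vG, zero_sub]
  congr 1
  simp only [Fintype.sum_sum_type, Fintype.sum_prod_type, todaE_inl_vG, mul_zero,
    Finset.sum_const_zero, zero_add, todaE_vG_vG, todaE_vM_vG, mul_ite]
  rw [Finset.sum_comm]
  refine Finset.sum_congr rfl fun e _ => ?_
  rw [Finset.sum_ite_eq' univ i, if_pos (Finset.mem_univ _)]

/-- For an input, the label is its value. [folklore] -/
private theorem opLab_of_input (i : ℕ) {u : Operand k τ} (hu : u.isGateRef = false) :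
    opLab P i u = P.opVal i u := by
  cases u with
  | var x => rfl
  | const c => rfl
  | gate j => simp [Operand.isGateRef] at hu

/-- **Operand values are transported**: label times tail value is the operand's value (given
the claim for the earlier gates). [cite: MalodPortier2008, Lemma 5 (proof)] -/
theorem opLab_mul_sval (i : ℕ) (hi : i ≤ P.size)
    (IH : ∀ (j : ℕ) (hj : j < i), sval P (vG ⟨j, lt_of_lt_of_le hj hi⟩) = P.gateVal j)
    (u : Operand k τ) : opLab P i u * sval P (opSrc P i u) = P.opVal i u := by
  cases u with
  | var x => simp [opLab, opSrc, sval_vS]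
  | const c => simp [opLab, opSrc, sval_vS]
  | gate j =>
    simp only [opLab, opSrc, ArithCircuit.opVal_gate]
    by_cases hj : j < i
    · have hjs : j < P.size := lt_of_lt_of_le hj hi
      rw [if_pos ⟨hj, hjs⟩, dif_pos ⟨hj, hjs⟩, if_pos hj, one_mul]
      exact IH j hj
    · rw [if_neg (fun h => hj h.1), dif_neg (fun h => hj h.1), if_neg hj, zero_mul]

/-- A gate of fan-in `≤ 2` has at most two slots. [folklore] -/
private theorem length_slots_le {g : Gate k τ} (hg : g.fanIn ≤ 2) : (slots g).length ≤ 2 := by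
  cases g with
  | sum args => simpa [slots, Gate.fanIn, Gate.args] using hg
  | prod args =>
    rcases args with _ | ⟨u₁, _ | ⟨u₂, _ | ⟨u₃, rest⟩⟩⟩
    · simp [slots]
    · simp [slots]
    · simp only [slots]
      split_ifs <;> simp
    · simp [slots]

/-- A sum over `Fin 2` of the entries of a list of length `≤ 2` is the list sum. [folklore] -/
private theorem sum_fin_two_getElem? {α R : Type*} [AddCommMonoid R] (l : List α) (hl : l.length ≤ 2)
    (F : α → R) : ∑ e : Fin 2, (l[e.1]?).elim 0 F = (l.map F).sum := by
  rcases l with _ | ⟨a, _ | ⟨b, _ | ⟨c, rest⟩⟩⟩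
  · simp
  · simp [Fin.sum_univ_two]
  · simp [Fin.sum_univ_two]
  · simp at hl

/-- **The slots of a gate compute the gate** (per-gate semantics of sums and skew products).
[cite: MalodPortier2008, Lemma 5 (proof)] -/
theorem sum_slots_eq_gateVal (i : ℕ) {g : Gate k τ} (hg : P.gates[i]? = some g)
    (h2 : g.fanIn ≤ 2) (hsk : g.IsSkew) :
    ((slots g).map fun d => P.opVal i d.1 * opLab P i d.2).sum = P.gateVal i := by
  cases g with
  | sum args =>
    rw [P.gateVal_of_sum hg]
    simp only [slots, List.map_map]
    congr 1
    refine List.map_congr_left fun a _ => ?_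
    simp only [Function.comp_apply, opLab, smul_eq_C_mul]
    ring
  | prod args =>
    rw [P.gateVal_of_prod hg]
    rcases args with _ | ⟨u₁, _ | ⟨u₂, _ | ⟨u₃, rest⟩⟩⟩
    · simp [slots, opLab]
    · simp [slots, opLab]
    · simp only [slots]
      split_ifs with h1
      · have h2' : u₂.isGateRef = false := by
          have hc : [u₁, u₂].countP Operand.isGateRef ≤ 1 := hsk
          simp only [List.countP_cons, List.countP_nil, h1] at hc
          cases h : u₂.isGateRef
          · rfl
          · simp [h] at hc
        simp only [List.map_cons, List.map_nil, List.sum_cons, List.sum_nil, List.prod_cons,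
          List.prod_nil, add_zero, mul_one]
        rw [opLab_of_input P i h2']
      · have h1' : u₁.isGateRef = false := by simpa using h1
        simp only [List.map_cons, List.map_nil, List.sum_cons, List.sum_nil, List.prod_cons,
          List.prod_nil, add_zero, mul_one]
        rw [opLab_of_input P i h1', mul_comm]
    · simp [Gate.fanIn, Gate.args] at h2

/-- **The value of every gate vertex is the value of its gate** (strong induction on the
gate number). [cite: MalodPortier2008, Lemma 5 (proof)] -/
theorem sval_vG (h2 : P.IsFanInTwo) (hsk : P.IsSkew) :
    ∀ (i : ℕ) (hi : i < P.size), sval P (vG ⟨i, hi⟩) = P.gateVal i := by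
  intro i
  induction i using Nat.strong_induction_on with
  | _ i IH =>
    intro hi
    obtain ⟨g, hg⟩ : ∃ g, P.gates[i]? = some g := ⟨P.gates[i], List.getElem?_eq_getElem hi⟩
    have hmem : g ∈ P.gates := List.mem_iff_getElem?.2 ⟨i, hg⟩
    have hslot : ∀ e : Fin 2, slot P ⟨i, hi⟩ e = (slots g)[e.1]? := fun e => by
      simp [slot, List.getD_eq_getElem?_getD, hg]
    have hne : (vG ⟨i, hi⟩ : TV P.size) ≠ vS := by simp
    rw [sval, if_neg hne, W_vG, zero_sub, neg_neg]
    have hterm : ∀ e : Fin 2, W P (vM ⟨i, hi⟩ e) * outLab P ⟨i, hi⟩ e =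
        ((slots g)[e.1]?).elim 0 (fun d => P.opVal i d.1 * opLab P i d.2) := by
      intro e
      rw [W_vM]
      simp only [inLab, inSrc, outLab, hslot e]
      cases (slots g)[e.1]? with
      | none => simp
      | some d =>
        show opLab P i d.1 * sval P (opSrc P i d.1) * opLab P i d.2 = P.opVal i d.1 * opLab P i d.2
        rw [opLab_mul_sval P i hi.le (fun j hj => IH j hj _) d.1]
    rw [Finset.sum_congr rfl fun e _ => hterm e, sum_fin_two_getElem? _ (length_slots_le (h2 g hmem)) _]
    exact sum_slots_eq_gateVal P i hg (h2 g hmem) (hsk g hmem)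

/-- **The circuit computes the path value into the target.**
[cite: MalodPortier2008, Lemma 5] -/
theorem eval_eq_W_vT (h2 : P.IsFanInTwo) (hsk : P.IsSkew) : P.eval = W P vT := by
  rw [W_vT, ArithCircuit.eval_eq_opVal_output,
    opLab_mul_sval P P.size le_rfl (fun j hj => sval_vG P h2 hsk j hj)]

/-- **Toda's matrix**: `det` of Lemma 6.2's merged matrix of the digraph is the polynomial
computed by the circuit. [cite: HuttenhainIkenmeyer2016, Prop. 5.2 (proof)] -/
theorem det_mergeMatrix_todaE (h2 : P.IsFanInTwo) (hsk : P.IsSkew) :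
    (mergeMatrix (todaE P) vS vT).det = P.eval := by
  rw [HuttenhainIkenmeyer.det_mergeMatrix_eq_pathValue (todaE_ranked P) (by simp),
    eval_eq_W_vT P h2 hsk]
  rfl

end Digraph

/-! ### The entries of Toda's matrix and Proposition 2.3 -/

section Entries

variable {τ : Type v}

/-- An integer variable matrix entry of absolute value `≤ 1`: a variable or `C c`, `|c| ≤ 1`
(the hypothesis of Prop. 2.3 with `c_max = 1`). [cite: HuttenhainIkenmeyer2016, Prop. 2.3] -/
def IsIntEntry (e : MvPolynomial τ ℤ) : Prop := (∃ v, e = X v) ∨ ∃ c : ℤ, e = C c ∧ c.natAbs ≤ 1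

/-- `0` is admissible. [folklore] -/
private theorem isIntEntry_zero : IsIntEntry (0 : MvPolynomial τ ℤ) := Or.inr ⟨0, by simp, by simp⟩

/-- `1` is admissible. [folklore] -/
private theorem isIntEntry_one : IsIntEntry (1 : MvPolynomial τ ℤ) := Or.inr ⟨1, by simp, by simp⟩

/-- A sign constant is admissible. [folklore] -/
private theorem isIntEntry_C {c : ℤ} (hc : IsSignConstant c) : IsIntEntry (C c : MvPolynomial τ ℤ) := by
  refine Or.inr ⟨c, rfl, ?_⟩
  rcases hc with rfl | rfl | h
  · simp
  · simp
  · omega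

variable (P : ArithCircuit ℤ τ)

/-- Operand labels are admissible. [folklore] -/
private theorem isIntEntry_opLab (i : ℕ) {u : Operand ℤ τ} (hu : u.HasSignConstants) :
    IsIntEntry (opLab P i u) := by
  cases u with
  | var x => exact Or.inl ⟨x, rfl⟩
  | const c => exact isIntEntry_C hu
  | gate j =>
    simp only [opLab]
    split_ifs
    · exact isIntEntry_one
    · exact isIntEntry_zero

/-- The slots of a constant-free gate carry constant-free operands. [folklore] -/
private theorem slots_hasSignConstants {g : Gate ℤ τ} (hg : g.HasSignConstants) :
    ∀ d ∈ slots g, d.1.HasSignConstants ∧ d.2.HasSignConstants := by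
  intro d hd
  cases g with
  | sum args =>
    simp only [slots, List.mem_map] at hd
    obtain ⟨a, ha, rfl⟩ := hd
    exact ⟨(hg a ha).2, (hg a ha).1⟩
  | prod args =>
    rcases args with _ | ⟨u₁, _ | ⟨u₂, _ | ⟨u₃, rest⟩⟩⟩
    · simp only [slots, List.mem_singleton] at hd
      subst hd
      exact ⟨isSignConstant_one, isSignConstant_one⟩
    · simp only [slots, List.mem_singleton] at hd
      subst hd
      exact ⟨hg u₁ (by simp), isSignConstant_one⟩
    · simp only [slots] at hd
      split_ifs at hd <;> simp only [List.mem_singleton] at hd <;> subst hd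
      · exact ⟨hg u₁ (by simp), hg u₂ (by simp)⟩
      · exact ⟨hg u₂ (by simp), hg u₁ (by simp)⟩
    · simp [slots] at hd

/-- **The entries of Toda's matrix are variables, `0` or `±1`.**
[cite: HuttenhainIkenmeyer2016, Prop. 5.2 (proof)] -/
theorem isIntEntry_todaE (hP : P.HasSignConstants) (u v : TV P.size) :
    IsIntEntry (todaE P u v) := by
  have hslot : ∀ (i : Fin P.size) (e : Fin 2) (d : Operand ℤ τ × Operand ℤ τ),
      slot P i e = some d → d.1.HasSignConstants ∧ d.2.HasSignConstants := by
    intro i e d hd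
    unfold slot at hd
    refine slots_hasSignConstants ?_ d (List.mem_of_getElem? hd)
    rw [List.getD_eq_getElem?_getD]
    cases hg : P.gates[(i : ℕ)]? with
    | none => intro a ha; simp at ha
    | some g => exact hP.1 g (List.mem_of_getElem? hg)
  rcases v with (⟨⟩ | ⟨⟩) | (i | ⟨i, e⟩)
  · exact isIntEntry_zero
  · rw [show (Sum.inl (Sum.inr PUnit.unit) : TV P.size) = vT from rfl, todaE_vT]
    split_ifs
    · exact isIntEntry_opLab P _ hP.2
    · exact isIntEntry_zero
  · rcases u with (y | y) | (j | ⟨i', e'⟩)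
    · rw [todaE_inl_vG]; exact isIntEntry_zero
    · rw [todaE_inl_vG]; exact isIntEntry_zero
    · rw [todaE_vG_vG]; exact isIntEntry_zero
    · rw [show (Sum.inr (Sum.inr (i', e')) : TV P.size) = vM i' e' from rfl, todaE_vM_vG]
      split_ifs with h
      · subst h
        unfold outLab
        cases hs : slot P i' e' with
        | none => exact isIntEntry_zero
        | some d => exact isIntEntry_opLab P _ (hslot _ _ d hs).2
      · exact isIntEntry_zero
  · rw [show (Sum.inr (Sum.inr (i, e)) : TV P.size) = vM i e from rfl, todaE_vM]
    split_ifs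
    · unfold inLab
      cases hs : slot P i e with
      | none => exact isIntEntry_zero
      | some d => exact isIntEntry_opLab P _ (hslot _ _ d hs).1
    · exact isIntEntry_zero

/-- The entries of the merged matrix are variables, `0` or `±1`.
[cite: HuttenhainIkenmeyer2016, Prop. 5.2 (proof)] -/
theorem isIntEntry_mergeMatrix (hP : P.HasSignConstants) (u v : {v : TV P.size // v ≠ vT}) :
    IsIntEntry (mergeMatrix (todaE P) vS vT u v) := by
  simp only [mergeMatrix, Matrix.of_apply, Matrix.add_apply]
  by_cases h : u.1 = (if v.1 = vS then vT else v.1)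
  · rw [← h, Matrix.one_apply_eq, todaE_apply_self, add_zero]
    exact isIntEntry_one
  · rw [Matrix.one_apply_ne h, zero_add]
    exact isIntEntry_todaE P hP _ _

/-- **`VP_s^0 ⊆ DET^0` for one circuit** (Hüttenhain–Ikenmeyer 2016, proof of Prop. 5.2:
Toda's matrix of a skew circuit has entries variables and `0, 1, −1`; "Proposition 2.3 makes it
binary"): a fan-in-two constant-free skew circuit with `s` gates computes the determinant of a
binary variable matrix of size `(3s+1) + 4(3s+1)²` (Prop. 2.3's explicit size with `c_max = 1`,
padded). [cite: HuttenhainIkenmeyer2016, Prop. 5.2 (proof)] -/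
theorem hasBinaryDetRepr_of_isSkew (P : ArithCircuit ℤ τ) (h2 : P.IsFanInTwo)
    (hs : P.HasSignConstants) (hsk : P.IsSkew) :
    HasBinaryDetRepr P.eval (3 * P.size + 1 + 4 * (3 * P.size + 1) ^ 2) := by
  classical
  have hcard : Fintype.card {v : TV P.size // v ≠ vT} = 3 * P.size + 1 := by
    simp only [Fintype.card_subtype_compl, Fintype.card_unique, card_TV]
    omega
  obtain ⟨e⟩ : Nonempty ({v : TV P.size // v ≠ vT} ≃ Fin (3 * P.size + 1)) :=
    ⟨Fintype.equivFinOfCardEq hcard⟩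
  set M : Matrix (Fin (3 * P.size + 1)) (Fin (3 * P.size + 1)) (MvPolynomial τ ℤ) :=
    Matrix.reindex e e (mergeMatrix (todaE P) vS vT) with hM
  have hMdet : M.det = P.eval := by
    rw [hM, Matrix.det_reindex_self, det_mergeMatrix_todaE P h2 hsk]
  have hMent : ∀ i j, (∃ v, M i j = X v) ∨ ∃ c : ℤ, M i j = C c ∧ c.natAbs ≤ 1 :=
    fun i j => isIntEntry_mergeMatrix P hs _ _
  have hrepr : HasBinaryDetRepr P.eval (Fintype.card (Fin (3 * P.size + 1) ⊕
      HuttenhainIkenmeyer.LadderV (HuttenhainIkenmeyer.gadgetLevels 1) ×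
        (Fin (3 * P.size + 1) × Fin (3 * P.size + 1)))) := by
    refine ⟨Matrix.reindex (Fintype.equivFin _) (Fintype.equivFin _)
        (HuttenhainIkenmeyer.prop6Matrix M 1),
      (HuttenhainIkenmeyer.isBinaryVariableMatrix_prop6Matrix M 1 hMent).submatrix _ _, ?_⟩
    rw [Matrix.det_reindex_self, HuttenhainIkenmeyer.det_prop6Matrix M 1 hMent, hMdet]
  refine hrepr.mono ((HuttenhainIkenmeyer.card_prop6Index_le (n := 3 * P.size + 1) 1).trans ?_)
  simp

/-- **`VP_s^0 ⊆ DET^0`** (Hüttenhain–Ikenmeyer 2016, Prop. 5.2, second inclusion).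
[cite: HuttenhainIkenmeyer2016, Prop. 5.2] -/
theorem isDETZeroFamily_of_isVPsZeroFamily {ς : ℕ → Type v} {f : ∀ n, MvPolynomial (ς n) ℤ}
    (hf : IsVPsZeroFamily f) : IsDETZeroFamily f := by
  obtain ⟨P, hP, hsize⟩ := hf
  refine ⟨fun n => 3 * (P n).size + 1 + 4 * (3 * (P n).size + 1) ^ 2, ?_, fun n => ?_⟩
  · have hlin : IsPBounded fun m => 3 * m + 1 :=
      IsPBounded.add_holds (IsPBounded.mul_holds (IsPBounded.const 3) IsPBounded.id)
        (IsPBounded.const 1)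
    have hpoly : IsPBounded fun m => 3 * m + 1 + 4 * (3 * m + 1) ^ 2 :=
      IsPBounded.add_holds hlin (IsPBounded.mul_holds (IsPBounded.const 4)
        (IsPBounded.pow_holds hlin 2))
    have key := IsPBounded.comp_holds hpoly hsize
    exact key
  · obtain ⟨h2, hs, hsk, hc⟩ := hP n
    have hc' : (P n).eval = f n := hc
    rw [← hc']
    exact hasBinaryDetRepr_of_isSkew (P n) h2 hs hsk

end Entries

end HI16Skew

/-! ## Proposition 5.2 -/

section PropTwelve

variable {ς : ℕ → Type v}

/-- **Proposition 5.2, discharged** (Hüttenhain–Ikenmeyer 2016, §5, p0009:L32): `VP_s^0 = DET^0`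
— a sequence of integer polynomials has polynomially bounded constant-free skew complexity iff
it has polynomially bounded binary determinantal complexity. `⊆`: Toda's matrix of a skew circuit
(entries variables, `0, ±1`, `HI16Skew.hasBinaryDetRepr_of_isSkew`) and Prop. 2.3
(`huttenhainIkenmeyer2016_prop6` in its explicit discharged form); `⊇`: a constant-free skew
circuit for the determinant (Toda 1992, Lemma 3.4 — here the tree's Mahajan–Vinay/Berkowitz
branching program `GKKP2011.abpValue_eq_detPoly`, `HI16Skew.exists_skewCircuit_detPoly`) with the
entries of the binary matrix substituted. Users are fed `huttenhainIkenmeyer2016_prop12_holds`.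
[cite: HuttenhainIkenmeyer2016, Prop. 5.2] -/
theorem huttenhainIkenmeyer2016_prop12_holds : huttenhainIkenmeyer2016_prop12 (ς := ς) :=
  fun _ => ⟨HI16Skew.isDETZeroFamily_of_isVPsZeroFamily, HI16Skew.isVPsZeroFamily_of_isDETZeroFamily⟩

end PropTwelve

end Literature.Computability.AlgebraicComplexity
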